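import Summits.CriticalPhenomena.PercolationContinuityZ3.Theorems.PercNearOneGluingNoHeavyQuantTwoLevelTopBlock
import Summits.CriticalPhenomena.PercolationContinuityZ3.Theorems.PercNearOneGluingNoHeavyQuantTreeClusterTransfer
import Literature.Probability.LatticeModels.ProdBernoulliBlocks
import HarnessLib

/-!
# QUANT lane R8, FAR on trees: the far-relay row for the branching family "hub with leaves + one root block",
# at the block's own layer — in gate coordinates (the vocabulary of `Quant.tree_relayCount_transfer` / `Quant.FarTreeRow`)

builds on p205010 (kernel theorem, internal audit signed; external expert review pending)

Support file (`--supports stmt-CriticalPhenomena-4575`), QUANT lane typer seat prim-quant-stmt (gen 10); memo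
`run/shared/lean/prim/quant/prim-quant-stmt-g10/TLB-NOTES.md` §5; companion of `…QuantTwoLevelTopBlock.lean` (`Quant.twoLevel_topBlock_tree`).
Theorems only; no definitions, no sorries, standard axioms.

**The family** (`prim-quant-lead-g6/LEAD-NOTES-G6.md` N14 (4), "loose hub + root block", first tree family beyond spiders): observer `o`;
a hub `h` (gate `q h`, child of `o`) whose children are leaf relays `L` (arbitrary gates); a second child `b` of `o` (gate `q b`) carrying a
glued block: `b` itself and further relays `B` below `b` with gate `1`; relay set `A = L ∪ {b} ∪ B`.  The vertex gates are independent
(`prodBernoulli q` on `Set (Fin n)`) and a relay is counted iff its whole ancestral line is open — exactly the right-hand side of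
`Quant.tree_relayCount_transfer`, so the result transfers verbatim to bond percolation with tree-supported weights on `Sym2 (Fin n)`.

* `Quant.farTree_hubTopBlock` — **FAR at layer `j = |B| + 1` (the block size) for this family**: if
  `2j < q h · Σ_{ℓ∈L} q ℓ + j · q b` (the mean hypothesis `2j < Σ_{a∈A} P(a reached)`: leaf marginals `q h · q ℓ`, block marginals `q b`)
  and `t ≥ 1 − q b`, `t ≥ 1 − q h · q ℓ₀` for a least reliable leaf `ℓ₀` (the cut hypotheses at the two candidates for the least likely
  relay), then `P(#{a ∈ A counted} ≤ j) ≤ t`.  Proof: `{count ≥ j+1} ⊇ {h open, ≥ j+1 leaves open} ⊔ {h open, 1 ≤ #open leaves ≤ j, block open}`;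
  the three coordinate groups `{h}`, `L`, `{b} ∪ B` are independent (`prodBernoulli_real_inter_of_determinedBy_disjoint`), the leaf events
  are read through the block principle (`prodBernoulli_real_preimage_readBlocks`) as events of `prodBernoulli (q|_L)`, and
  `Quant.twoLevel_topBlock_tree` bounds `q h · (A + q b · B) ≥ min(q b, q h · q ℓ₀)`.
  Layers `j < |B| + 1` are trivial (the block alone), layers `j > |B| + 1` are OPEN (memo §5–§6: one Poisson-binomial tail-ratio inequality).
[cite: KozmaNitzan2024, Conjecture 3 (p. 15)] (the gluing rows served); the family result is [this work].
-/

noncomputable section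

namespace Summit.CriticalPhenomena.PercolationContinuityZ3.Theorems

namespace Quant

open Finset MeasureTheory
open Literature.Probability.LatticeModels
open Literature.Probability.Percolation
open scoped Classical

variable {n : ℕ}

/-- An event that only reads the coordinates of `F` through `F.filter (· ∈ ω)` is determined by `F`. [folklore] -/
theorem determinedBy_of_filter (F : Finset (Fin n)) (Φ : Finset (Fin n) → Prop) :
    DeterminedBy {ω : Set (Fin n) | Φ (F.filter fun x => x ∈ ω)} (↑F : Set (Fin n)) := by
  rw [determinedBy_iff]
  intro ω ω' h
  have : (F.filter fun x => x ∈ ω) = (F.filter fun x => x ∈ ω') := by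
    ext x
    simp only [Finset.mem_filter, and_congr_right_iff]
    intro hx
    have h1 : x ∈ ω ∩ (↑F : Set (Fin n)) ↔ x ∈ ω' ∩ (↑F : Set (Fin n)) := by rw [h]
    simpa [hx] using h1
  simp only [Set.mem_setOf_eq, this]

/-- **Reading the leaves**: for a finset `L` of coordinates, the law of `#(L ∩ ω)`-events under `prodBernoulli q` is that of
`prodBernoulli (q ∘ Subtype.val)` on `Set ↥L` (block principle, one block per leaf). [folklore] -/
theorem prodBernoulli_real_leafCount (q : Fin n → unitInterval) (L : Finset (Fin n)) (hL : L.Nonempty)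
    (Ψ : ℕ → Prop) :
    (prodBernoulli q).real {ω : Set (Fin n) | Ψ (L.filter fun x => x ∈ ω).card} =
      (prodBernoulli (fun j : ↥L => q j)).real {s : Set ↥L | Ψ (univ.filter fun j => j ∈ s).card} := by
  obtain ⟨ℓ₁, hℓ₁⟩ := hL
  set blk : Fin n → ↥L := fun x => if hx : x ∈ L then ⟨x, hx⟩ else ⟨ℓ₁, hℓ₁⟩ with hblk
  set g : ↥L → Set (Fin n) → Prop := fun j ω => (j : Fin n) ∈ ω with hg
  have hblkval : ∀ j : ↥L, blk j = j := by
    intro j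
    simp only [hblk, dif_pos j.2]
  have hloc : IsBlockLocal blk g := by
    intro j ω ω' hagree
    exact hagree _ (hblkval j)
  have hmeas : ∀ j, Measurable (g j) := fun j => Measurable.of_discrete
  have hq : ∀ j : ↥L, (prodBernoulli q).real {ω | g j ω} = (fun j : ↥L => q j) j := by
    intro j
    simp only [hg]
    exact prodBernoulli_real_setOf_mem q j
  have hread := prodBernoulli_real_preimage_readBlocks q blk hloc hmeas (fun j : ↥L => q j) hq
    (S := {s : Set ↥L | Ψ (univ.filter fun j => j ∈ s).card}) MeasurableSet.of_discrete
  rw [← hread]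
  congr 1
  ext ω
  -- the two counts agree
  have hcount : (L.filter fun x => x ∈ ω).card = (univ.filter fun j : ↥L => (j : Fin n) ∈ ω).card := by
    have hmap : ((univ.filter fun j : ↥L => (j : Fin n) ∈ ω).map (Function.Embedding.subtype _)) =
        L.filter fun x => x ∈ ω := by
      ext x
      simp only [Finset.mem_map, Finset.mem_filter, Finset.mem_univ, true_and, Function.Embedding.coe_subtype]
      constructor
      · rintro ⟨j, hj, rfl⟩; exact ⟨j.2, hj⟩
      · rintro ⟨hxL, hxω⟩; exact ⟨⟨x, hxL⟩, hxω, rfl⟩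
    rw [← hmap, Finset.card_map]
  simp only [Set.mem_preimage, Set.mem_setOf_eq, hg, hcount]

/-- **FAR at the block's layer for the family "hub with leaves + one root block" (gate coordinates).**  Vertices `Fin n` with independent
gates `q`; observer `o`; hub `h` with leaf relays `L` (parent `h`, depth `1`, `ℓ₀ ∈ L` least reliable); block vertex `b`
(parent `o`, depth `0`) with further block relays `B` (parent `b`, depth `1`, gates `1`); `h, b ∉ L`, `h, b ∉ B`, `L ∩ B = ∅`, `h ≠ b`;
relays `A = L ∪ {b} ∪ B`; layer `j = |B| + 1`.  If `2j < q h · Σ_{ℓ∈L} q ℓ + j · q b` and `1 − q b ≤ t`, `1 − q h · q ℓ₀ ≤ t`, then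
`P(#{a ∈ A | a = o ∨ all ancestral gates open} ≤ j) ≤ t`.  The tight direction of the two-level core (memo §5); via `Quant.twoLevel_topBlock_tree`.
[this work] -/
theorem farTree_hubTopBlock (q : Fin n → unitInterval) (o h b ℓ₀ : Fin n) (L B : Finset (Fin n))
    (depth : Fin n → ℕ) (par : Fin n → Fin n) (j : ℕ) (t : ℝ)
    (hb : par b = o ∧ depth b = 0) (hhb : h ≠ b)
    (hL : ∀ a ∈ L, par a = h ∧ depth a = 1) (hB : ∀ a ∈ B, par a = b ∧ depth a = 1)
    (hhL : h ∉ L) (hbL : b ∉ L) (hhB : h ∉ B) (hbB : b ∉ B) (hLB : Disjoint L B) (hℓ₀ : ℓ₀ ∈ L)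
    (hmin : ∀ a ∈ L, (q ℓ₀ : ℝ) ≤ q a) (hqB : ∀ a ∈ B, (q a : ℝ) = 1) (hj : B.card + 1 = j)
    (hEN : (2 * j : ℝ) < (q h : ℝ) * ∑ a ∈ L, (q a : ℝ) + j * (q b : ℝ))
    (htb : 1 - (q b : ℝ) ≤ t) (htℓ : 1 - (q h : ℝ) * (q ℓ₀ : ℝ) ≤ t) :
    (prodBernoulli q).real {ω' : Set (Fin n) |
      ((L ∪ insert b B).filter fun a => a = o ∨ ∀ i, i ≤ depth a → par^[i] a ∈ ω').card ≤ j} ≤ t := by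
  set μ := prodBernoulli q with hμ
  set A : Finset (Fin n) := L ∪ insert b B with hA
  set cnt : Set (Fin n) → ℕ := fun ω' => (A.filter fun a => a = o ∨ ∀ i, i ≤ depth a → par^[i] a ∈ ω').card with hcnt
  set X : Set (Fin n) → ℕ := fun ω' => (L.filter fun a => a ∈ ω').card with hX
  have hmeas : ∀ S : Set (Set (Fin n)), MeasurableSet S := fun S => MeasurableSet.of_discrete
  have hG0 : (0 : ℝ) ≤ q h := (q h).2.1
  have hG1 : (q h : ℝ) ≤ 1 := (q h).2.2
  have hg0 : (0 : ℝ) ≤ q b := (q b).2.1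
  -- degenerate gates: the bound is trivial
  by_cases hGpos : (q h : ℝ) = 0
  · have : 1 ≤ t := by rw [hGpos, zero_mul, sub_zero] at htℓ; exact htℓ
    exact le_trans measureReal_le_one this
  by_cases hgpos : (q b : ℝ) = 0
  · have : 1 ≤ t := by rw [hgpos, sub_zero] at htb; exact htb
    exact le_trans measureReal_le_one this
  have hGpos' : 0 < (q h : ℝ) := lt_of_le_of_ne hG0 (Ne.symm hGpos)
  have hgpos' : 0 < (q b : ℝ) := lt_of_le_of_ne hg0 (Ne.symm hgpos)
  -- what is counted: sufficient conditions
  have cnt_leaf : ∀ ω' : Set (Fin n), h ∈ ω' → ∀ a ∈ L, a ∈ ω' →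
      a ∈ A.filter fun a => a = o ∨ ∀ i, i ≤ depth a → par^[i] a ∈ ω' := by
    intro ω' hhω a haL haω
    rw [Finset.mem_filter]
    refine ⟨Finset.mem_union_left _ haL, Or.inr fun i hi => ?_⟩
    obtain ⟨hpa, hda⟩ := hL a haL
    rw [hda] at hi
    interval_cases i
    · simpa using haω
    · simpa [hpa] using hhω
  have cnt_b : ∀ ω' : Set (Fin n), b ∈ ω' → b ∈ A.filter fun a => a = o ∨ ∀ i, i ≤ depth a → par^[i] a ∈ ω' := by
    intro ω' hbω
    rw [Finset.mem_filter]
    refine ⟨Finset.mem_union_right _ (Finset.mem_insert_self _ _), Or.inr fun i hi => ?_⟩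
    rw [hb.2] at hi
    interval_cases i
    simpa using hbω
  have cnt_B : ∀ ω' : Set (Fin n), b ∈ ω' → ∀ a ∈ B, a ∈ ω' →
      a ∈ A.filter fun a => a = o ∨ ∀ i, i ≤ depth a → par^[i] a ∈ ω' := by
    intro ω' hbω a haB haω
    rw [Finset.mem_filter]
    refine ⟨Finset.mem_union_right _ (Finset.mem_insert_of_mem haB), Or.inr fun i hi => ?_⟩
    obtain ⟨hpa, hda⟩ := hB a haB
    rw [hda] at hi
    interval_cases i
    · simpa using haω
    · simpa [hpa] using hbω
  -- the two disjoint sub-events of `{cnt ≥ j+1}`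
  set H : Set (Set (Fin n)) := {ω' | h ∈ ω'} with hH
  set E1 : Set (Set (Fin n)) := {ω' | j + 1 ≤ X ω'} with hE1
  set E2 : Set (Set (Fin n)) := {ω' | 1 ≤ X ω' ∧ X ω' ≤ j} with hE2
  set K : Set (Set (Fin n)) := {ω' | ((insert b B : Finset (Fin n)) : Set (Fin n)) ⊆ ω'} with hK
  have hsub1 : H ∩ E1 ⊆ {ω' | j + 1 ≤ cnt ω'} := by
    rintro ω' ⟨hhω, hE⟩
    have hincl : (L.filter fun a => a ∈ ω') ⊆ A.filter fun a => a = o ∨ ∀ i, i ≤ depth a → par^[i] a ∈ ω' := by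
      intro a ha
      rw [Finset.mem_filter] at ha
      exact cnt_leaf ω' hhω a ha.1 ha.2
    have := Finset.card_le_card hincl
    show j + 1 ≤ cnt ω'
    exact le_trans hE this
  have hsub2 : H ∩ (E2 ∩ K) ⊆ {ω' | j + 1 ≤ cnt ω'} := by
    rintro ω' ⟨hhω, ⟨hE1', -⟩, hKω⟩
    have hbω : b ∈ ω' := hKω (Finset.mem_coe.2 (Finset.mem_insert_self _ _))
    have hincl : (L.filter fun a => a ∈ ω') ∪ insert b B ⊆
        A.filter fun a => a = o ∨ ∀ i, i ≤ depth a → par^[i] a ∈ ω' := by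
      intro a ha
      rcases Finset.mem_union.1 ha with ha | ha
      · rw [Finset.mem_filter] at ha
        exact cnt_leaf ω' hhω a ha.1 ha.2
      · rcases Finset.mem_insert.1 ha with rfl | haB
        · exact cnt_b ω' hbω
        · exact cnt_B ω' hbω a haB (hKω (Finset.mem_coe.2 (Finset.mem_insert_of_mem haB)))
    have hdisj : Disjoint (L.filter fun a => a ∈ ω') (insert b B) := by
      rw [Finset.disjoint_left]
      intro a ha ha'
      rw [Finset.mem_filter] at ha
      rcases Finset.mem_insert.1 ha' with rfl | haB
      · exact hbL ha.1
      · exact Finset.disjoint_left.1 hLB ha.1 haB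
    have hcard := Finset.card_le_card hincl
    rw [Finset.card_union_of_disjoint hdisj, Finset.card_insert_of_notMem hbB] at hcard
    have h1L : 1 ≤ (L.filter fun a => a ∈ ω').card := hE1'
    show j + 1 ≤ (A.filter fun a => a = o ∨ ∀ i, i ≤ depth a → par^[i] a ∈ ω').card
    omega
  have hdisjE : Disjoint (H ∩ E1) (H ∩ (E2 ∩ K)) := by
    rw [Set.disjoint_left]
    rintro ω' ⟨-, h1⟩ ⟨-, ⟨-, h2⟩, -⟩
    have h1' : j + 1 ≤ X ω' := h1
    omega
  -- probability bookkeeping: `P(cnt ≤ j) = 1 − P(cnt ≥ j+1) ≤ 1 − P(H ∩ E1) − P(H ∩ E2 ∩ K)`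
  have hcompl : μ.real {ω' | cnt ω' ≤ j} = 1 - μ.real {ω' | j + 1 ≤ cnt ω'} := by
    have : {ω' : Set (Fin n) | cnt ω' ≤ j} = {ω' | j + 1 ≤ cnt ω'}ᶜ := by
      ext ω'; simp only [Set.mem_setOf_eq, Set.mem_compl_iff]; omega
    rw [this, probReal_compl_eq_one_sub (hmeas _)]
  have hlow : μ.real (H ∩ E1) + μ.real (H ∩ (E2 ∩ K)) ≤ μ.real {ω' | j + 1 ≤ cnt ω'} := by
    rw [← measureReal_union hdisjE (hmeas _)]
    exact measureReal_mono (Set.union_subset hsub1 hsub2) (measure_ne_top _ _)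
  -- independence of the coordinate groups `{h}`, `L`, `insert b B`
  have hdetH : DeterminedBy H (↑({h} : Finset (Fin n)) : Set (Fin n)) := by
    rw [determinedBy_iff]
    intro ω ω' hagree
    have hhS : h ∈ (↑({h} : Finset (Fin n)) : Set (Fin n)) := by simp
    show h ∈ ω ↔ h ∈ ω'
    constructor
    · intro hω
      have : h ∈ ω ∩ ↑({h} : Finset (Fin n)) := ⟨hω, hhS⟩
      rw [hagree] at this
      exact this.1
    · intro hω
      have : h ∈ ω' ∩ ↑({h} : Finset (Fin n)) := ⟨hω, hhS⟩
      rw [← hagree] at this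
      exact this.1
  have hdetE1 : DeterminedBy E1 (↑L : Set (Fin n)) := determinedBy_of_filter L (fun F => j + 1 ≤ F.card)
  have hdetE2 : DeterminedBy E2 (↑L : Set (Fin n)) := determinedBy_of_filter L (fun F => 1 ≤ F.card ∧ F.card ≤ j)
  have hdetK : DeterminedBy K (↑(insert b B) : Set (Fin n)) := by
    rw [determinedBy_iff]
    intro ω ω' hagree
    show ((insert b B : Finset (Fin n)) : Set (Fin n)) ⊆ ω ↔ ((insert b B : Finset (Fin n)) : Set (Fin n)) ⊆ ω'
    constructor
    · intro hω x hx
      have : x ∈ ω ∩ ↑(insert b B) := ⟨hω hx, hx⟩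
      rw [hagree] at this
      exact this.1
    · intro hω x hx
      have : x ∈ ω' ∩ ↑(insert b B) := ⟨hω hx, hx⟩
      rw [← hagree] at this
      exact this.1
  have hdetE2K : DeterminedBy (E2 ∩ K) (↑(L ∪ insert b B) : Set (Fin n)) := by
    refine DeterminedBy.inter (hdetE2.mono ?_) (hdetK.mono ?_)
    · intro x hx; exact Finset.mem_coe.2 (Finset.mem_union_left _ (Finset.mem_coe.1 hx))
    · intro x hx; exact Finset.mem_coe.2 (Finset.mem_union_right _ (Finset.mem_coe.1 hx))
  have hdj1 : Disjoint ({h} : Finset (Fin n)) L := Finset.disjoint_singleton_left.2 hhL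
  have hdj2 : Disjoint ({h} : Finset (Fin n)) (L ∪ insert b B) := by
    rw [Finset.disjoint_singleton_left, Finset.mem_union, Finset.mem_insert, not_or, not_or]
    exact ⟨hhL, hhb, hhB⟩
  have hdj3 : Disjoint L (insert b B) := by
    rw [Finset.disjoint_insert_right]; exact ⟨hbL, hLB⟩
  have hPH : μ.real H = q h := prodBernoulli_real_setOf_mem q h
  have hPK : μ.real K = q b := by
    rw [hK, hμ, prodBernoulli_real_subset, Finset.prod_insert hbB]
    rw [Finset.prod_eq_one fun a ha => hqB a ha, mul_one]
  have hP1 : μ.real (H ∩ E1) = q h * μ.real E1 := by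
    rw [prodBernoulli_real_inter_of_determinedBy_disjoint q hdj1 hdetH hdetE1 (hmeas _) (hmeas _), hPH]
  have hP2 : μ.real (H ∩ (E2 ∩ K)) = q h * (q b * μ.real E2) := by
    rw [prodBernoulli_real_inter_of_determinedBy_disjoint q hdj2 hdetH hdetE2K (hmeas _) (hmeas _), hPH,
      prodBernoulli_real_inter_of_determinedBy_disjoint q hdj3 hdetE2 hdetK (hmeas _) (hmeas _), hPK, mul_comm (μ.real E2)]
  -- the leaf events as events of `prodBernoulli (q|_L)` and the two-level inequality
  set p : ↥L → unitInterval := fun a => q a with hp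
  have hLne : L.Nonempty := ⟨ℓ₀, hℓ₀⟩
  have hE1' : μ.real E1 = (prodBernoulli p).real {s : Set ↥L | j + 1 ≤ 0 + (univ.filter fun i => i ∈ s).card} := by
    have := prodBernoulli_real_leafCount q L hLne (fun m => j + 1 ≤ 0 + m)
    simp only [zero_add] at this ⊢
    exact this
  have hE2' : μ.real E2 = (prodBernoulli p).real {s : Set ↥L | 1 ≤ 0 + (univ.filter fun i => i ∈ s).card ∧
      0 + (univ.filter fun i => i ∈ s).card ≤ j} := by
    have := prodBernoulli_real_leafCount q L hLne (fun m => 1 ≤ 0 + m ∧ 0 + m ≤ j)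
    simp only [zero_add] at this ⊢
    exact this
  have hsumL : ∑ i : ↥L, (p i : ℝ) = ∑ a ∈ L, (q a : ℝ) := by
    rw [hp]; exact Finset.sum_coe_sort L (fun a => (q a : ℝ))
  have hEN' : (2 * j : ℝ) < (q h : ℝ) * ((0 : ℕ) + ∑ i : ↥L, (p i : ℝ)) + j * (q b : ℝ) := by
    rw [hsumL]; push_cast; rw [zero_add]; exact hEN
  have hmin' : ∀ i : ↥L, ((p ⟨ℓ₀, hℓ₀⟩ : unitInterval) : ℝ) ≤ p i := fun i => hmin i i.2
  have key := twoLevel_topBlock_tree p 0 j (q h) (q b) hGpos' hgpos' ⟨ℓ₀, hℓ₀⟩ hmin' hEN'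
  rw [← hE1', ← hE2'] at key
  -- assemble
  have hθ : 1 - t ≤ min ((q b : unitInterval) : ℝ) ((q h : ℝ) * p ⟨ℓ₀, hℓ₀⟩) := by
    rw [le_min_iff]; constructor
    · linarith
    · show 1 - t ≤ (q h : ℝ) * (q ℓ₀ : ℝ); linarith
  rw [hcompl]
  have : 1 - t ≤ μ.real {ω' | j + 1 ≤ cnt ω'} := by
    calc 1 - t ≤ min ((q b : unitInterval) : ℝ) ((q h : ℝ) * p ⟨ℓ₀, hℓ₀⟩) := hθ
      _ ≤ (q h : ℝ) * (μ.real E1 + (q b : ℝ) * μ.real E2) := key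
      _ = μ.real (H ∩ E1) + μ.real (H ∩ (E2 ∩ K)) := by rw [hP1, hP2]; ring
      _ ≤ μ.real {ω' | j + 1 ≤ cnt ω'} := hlow
  linarith

end Quant

end Summit.CriticalPhenomena.PercolationContinuityZ3.Theorems

end
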